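import Summits.QuantumFields.YangMills.Theorems.UnitScaleTiltHalvingP1FlatCoreTopDictionary
import Literature.MathematicalPhysics.QuantumFieldTheory.Balaban1983to89.B9Eq316TowerFlatIsOneStep
import Literature.MathematicalPhysics.QuantumFieldTheory.Balaban1983to89.B7Prop4GeneralLevels
import HarnessLib

/-!
# Line H (`BirthV10.stub_halvingStep`, stmt-QuantumFields-19200), J4c∕(P3-top) **(T4b) FILE 1b: THE BOND DICTIONARY** — (S2) for BOND fields: N05's
# composed LINEAR restriction functional `L^kη·Q_k(1)` on `ℤᵈ` (`B7Prop4GeneralLevels.linCovIter L 1`, [Balaban1985Averaging] (127) at the flat background) IS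
# `Lᵏ ·` the torus iterated bond average `bondAvgIter k` ([Balaban1984PropagatorsI] (1.18)) read through the universal cover

Cell `ym3-torus` (HUMAN RULING D-0037: YM₃ on T³ is ladder rung R3, NOT the Clay problem), width seat `ym-ust-19936-w8` gen 2.
`--supports stmt-QuantumFields-19200 --as helper`; THEOREMS ONLY (0 `def`, 0 `sorry`); count-neutral; nothing here claims `core′`, the stub, the crux or the gap.

WHY.  The (1.42) clause of [Balaban1985RegularSpaces] Prop. 3 at the TOP level of the H-line (row (P3-top)) is reached through the LINEAR parts, where the torus
(symmetrised, centred) and `ℤᵈ` (comb, corner) averaging conventions AGREE (both are plain bond-block means at the flat background): the comb side's nonlinear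
remainder is ✓`B7Prop4GeneralLevels.prop4_general_of_prop3` (`‖Q_k − linCovIter_k‖ ≤ C(Lᵏb)²`), the torus side's is ✓`Prop8ChartDoubleBarOneStepLog.norm_mlog_dbar_sub_segMean_le`,
and THIS FILE is the identification of the two linear parts under the cover `π` (companion of ✓`P1FlatCoreTopDictionary.siteAvgIter_comp_rep_coverAt_eq_qprimeIter`):
* §1 `runSite_cover`, `segSum_cover` — straight contours lift: `runSite (π w) μ t = π (w + t·e_μ)`;
* §2 ★ `bondAvgIter_coverAt` — `(Q_k A)⟨π_k z, κ⟩ = (L^{(d+1)k})⁻¹ · Σ_{w ∈ Bᵏ(z)} Σ_{t<Lᵏ} A⟨π(w + t·e_κ), κ⟩` (✓`B5Eq118OneStroke.bondAvgIter_eq_blockSum` +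
  ✓`Node00.sum_blockSites_comp_cover`);
* §3 ★★ `linCovIter_one_eq_smul_bondAvgIter` — for a bounded `ℤᵈ` bond field `B` reading a torus bond field through the cover (`B w μ = A ⟨π w, μ⟩`):
  `linCovIter L 1 B k z κ = Lᵏ • bondAvgIter k A ⟨π_k z, κ⟩` (✓`B9Eq316TowerFlatIsOneStep.linCovIter_one_left` + ✓`B7Prop4Flat.linQIter_eq_linQ_pow`∕`linQ_eq_sum` +
  ✓`B7Eq214FlatQprime.sum_blockSites_eq_sum_boxVec`).
HONEST SCOPE.  Bookkeeping over landed letters; no estimate; nothing of Prop. 3∕4∕5 is proved here.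

References: T. Bałaban, CMP **98** (1985) 17–51 [Balaban1985Averaging] ((125)–(127) pp.36–37); CMP **95** (1984) 17–40 [Balaban1984PropagatorsI] ((1.11), (1.18) pp.19–20);
CMP **99** (1985) 75–102 [Balaban1985RegularSpaces] ((1.42) p.83, (1.56) p.86); CMP **116** (1988) [Balaban1987RG1] ((0.1) p.251).
-/

set_option autoImplicit false

noncomputable section

open scoped BigOperators

namespace Summit.QuantumFields.YangMills.Theorems.P1FlatCoreTopBondDictionary

open Literature.MathematicalPhysics.QuantumFieldTheory.Balaban1983to89
open T4Continuum
open B15Eq112TorusCover (cover cover_apply)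
open B14DomainGeom (Pt)
open Node00 (coverAt sum_blockSites_comp_cover)
open LatticeFieldCalculus (bondAvgIter segSum runSite runBond)
open Literature.MathematicalPhysics.QuantumLattice (blockSites)
open B7Prop1Explicit (e e_apply boxVec)
open B7Prop4GeneralLevels (linCovIter)
open B7Prop4Flat (linQIter linQ_eq_sum linQIter_eq_linQ_pow)
open B7Eq214FlatQprime (sum_blockSites_eq_sum_boxVec)
open B9Eq316TowerFlatIsOneStep (linCovIter_one_left)
open B5Eq118OneStroke (bondAvgIter_eq_blockSum)

variable {P : Params}

/-! ## §1 Straight contours under the cover -/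

section Contours

/-- `runSite (π w) μ t = π (w + t·e_μ)`: straight contours lift to the cover. [cite: Balaban1984PropagatorsI, (1.7) p.18; Balaban1987RG1, (0.1) p.251] -/
theorem runSite_cover (w : Pt P.d) (μ : Fin P.d) (t : ℕ) : runSite (cover P w) μ t = cover P (w + (t : ℤ) • e μ) := by
  funext ν
  simp only [runSite, Function.update_apply, cover_apply, Pi.add_apply, Pi.smul_apply, e_apply, smul_eq_mul]
  by_cases h : ν = μ
  · subst h; simp
  · simp [h]

variable {V : Type*} [AddCommGroup V] [Module ℝ V]

omit [Module ℝ V] in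
/-- The straight-segment sum from a covered site reads the field on the lifted bonds. [cite: Balaban1984PropagatorsI, (1.8) p.18] -/
theorem segSum_cover (A : VecField P 0 V) (w : Pt P.d) (μ : Fin P.d) (n : ℕ) :
    segSum A (cover P w) μ n = ∑ t ∈ Finset.range n, A ⟨cover P (w + (t : ℤ) • e μ), μ⟩ := by
  unfold segSum
  refine Finset.sum_congr rfl fun t _ => ?_
  rw [runBond, runSite_cover]

end Contours

/-! ## §2 The iterated bond average on the cover -/

section BondAvg

variable {V : Type*} [AddCommGroup V] [Module ℝ V]

/-- ★ **`Q_k` ON THE COVER**: `(Q_k A)⟨π_k z, κ⟩ = ((L^{d+1})ᵏ)⁻¹ • Σ_{w ∈ Bᵏ(z)} Σ_{t < Lᵏ} A⟨π(w + t·e_κ), κ⟩` (standing range) — [Balaban1984PropagatorsI] (1.18) with the torus block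
of order `k` replaced by its `ℤᵈ` lift. [cite: Balaban1984PropagatorsI, (1.18) p.20; Balaban1987RG1, (0.1) p.251] -/
theorem bondAvgIter_coverAt {k : ℕ} (hk : k ≤ P.m + P.K) (A : VecField P 0 V) (z : Pt P.d) (κ : Fin P.d) :
    bondAvgIter k A ⟨coverAt P k z, κ⟩ =
      ((((P.L : ℝ) ^ (P.d + 1)) ^ k)⁻¹) • ∑ w ∈ blockSites (P.L ^ k) z, ∑ t ∈ Finset.range (P.L ^ k), A ⟨cover P (w + (t : ℤ) • e κ), κ⟩ := by
  rw [bondAvgIter_eq_blockSum k hk A ⟨coverAt P k z, κ⟩]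
  show ((((P.L : ℝ) ^ (P.d + 1)) ^ k)⁻¹) • ∑ x ∈ B5Eq118OneStroke.iterBlock k (coverAt P k z), segSum A x κ (P.L ^ k) = _
  rw [← sum_blockSites_comp_cover hk z (fun x => segSum A x κ (P.L ^ k))]
  congr 1
  exact Finset.sum_congr rfl fun w _ => segSum_cover A w κ _

end BondAvg

/-! ## §3 The bond dictionary: `linCovIter L 1 = Lᵏ · bondAvgIter k` under the cover -/

section Dictionary

variable {𝔸 : Type*} [NormedRing 𝔸] [NormedAlgebra ℂ 𝔸] [CompleteSpace 𝔸] [NormOneClass 𝔸]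

/-- ★★ **THE BOND DICTIONARY.**  For a bounded `ℤᵈ` bond field `B` that reads a torus bond field `A` through the cover (`B w μ = A⟨π w, μ⟩`), N05's composed linear
restriction functional at the flat background is `Lᵏ` times the torus iterated bond average: `linCovIter L 1 B k z κ = Lᵏ • (Q_k A)⟨π_k z, κ⟩` — both are
`L^{−dk} Σ_{w ∈ Bᵏ(z)} Σ_{t<Lᵏ} B(w + t·e_κ, κ)`. [cite: Balaban1985Averaging, (125)-(127) pp.36-37; Balaban1984PropagatorsI, (1.18) p.20; Balaban1985RegularSpaces, (1.56) p.86] -/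
theorem linCovIter_one_eq_smul_bondAvgIter {k : ℕ} (hk : k ≤ P.m + P.K) (A : PBond P 0 → 𝔸) (B : Pt P.d → Fin P.d → 𝔸) {b : ℝ} (hb : 0 ≤ b)
    (hB : ∀ w μ, ‖B w μ‖ ≤ b) (hBA : ∀ w μ, B w μ = A ⟨cover P w, μ⟩) (z : Pt P.d) (κ : Fin P.d) :
    linCovIter P.L (1 : Pt P.d → Fin P.d → 𝔸ˣ) B k z κ = ((P.L : ℝ) ^ k) • bondAvgIter k A ⟨coverAt P k z, κ⟩ := by
  have hL : 1 ≤ P.L := P.L_pos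
  have hL0 : (P.L : ℝ) ≠ 0 := by exact_mod_cast P.L_pos.ne'
  rw [linCovIter_one_left P.L hL B hb hB k, linQIter_eq_linQ_pow, linQ_eq_sum, bondAvgIter_coverAt hk A z κ, smul_smul,
    ← sum_blockSites_eq_sum_boxVec (P.L ^ k) z (fun w => (((((P.L ^ k : ℕ) : ℝ)) ^ P.d)⁻¹) • ∑ i : Fin (P.L ^ k), B (w + ((i : ℕ) : ℤ) • e κ) κ),
    Finset.smul_sum]
  refine Finset.sum_congr rfl fun w _ => ?_
  rw [Finset.sum_range fun t => A ⟨cover P (w + (t : ℤ) • e κ), κ⟩]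
  congr 1
  · push_cast
    rw [← pow_mul, ← pow_mul, show (P.d + 1) * k = k + P.d * k by ring, pow_add, mul_inv, ← mul_assoc, mul_inv_cancel₀ (pow_ne_zero _ hL0),
      one_mul, mul_comm]
  · exact Finset.sum_congr rfl fun i _ => hBA _ _

end Dictionary

end Summit.QuantumFields.YangMills.Theorems.P1FlatCoreTopBondDictionary

end
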